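/-
Copyright (c) 2026. All rights reserved.
Released under Apache 2.0 license as described in the file LICENSE.
Authors: abc-iut cell, wave-4 seat abc-iut-w4-d059 (proof-only; the reference pro-branch of the chosen
representatives and `Π^temp_{𝔊,b}` as a pair-stabiliser, dictionary inputs only).
-/
import Literature.AnabelianGeometry.SemiGraphs.ArithEdgeStabilizerInputsCpt
import Literature.AnabelianGeometry.SemiGraphs.ArithReferencePair
import HarnessLib

/-!
# (compact-`C` twin, α12-1)  [SemiAnbd] §5 p. 65 / Thm 5.4 (i): the reference pro-branch of `Π^temp_{𝔾,b} ⊆ Π^temp_{𝔾,v}` and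
# `Π^temp_{𝔊,b}` as its stabiliser, from the geometric dictionaries alone (proof-only)

Mochizuki, *Semi-graphs of anabelioids*, Publ. RIMS **42** (2006), §5 p. 65 ("`Π^temp_{𝔊,b} ⊆ Π^temp_{𝔊,v}`
… may be thought of as the commensurator in `Π^temp_{𝔊,v}` of `Π^temp_{𝔾,b}`") and the proofs of Thm 3.7
(iii) p. 41 / Thm 5.4 (i) p. 66 with the author's Comments (6). [cite: MochizukiSemiAnbd2006, §5, p. 65]

PROOF-ONLY sequel to `ArithEdgeStabilizerInputs.lean` (abc-iut cell, sub-DAG SemiAnbd-Thm54, row T54-0b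
(AI3) edge twin, seat abc-iut-w4-d059; packager abc-iut-w4-d053).  DISCHARGES the producer-side binders
`hX` / `hY` (reference pro-vertices / pro-branches of the chosen representatives) of this seat's
`ArithEdgeStabilizer.lean`:

* `ends_eq_or_swap_of_stabilizer_iff` — a NONTRIVIAL subgroup of `Π^temp_𝔾` determines the pair of
  compatible systems of which it is the full stabiliser, up to order (`not_three_fixed_of_ne_bot`);
* `exists_referencePair` — for `b` abutting to `v`: an end pair `(x, y)` with `R.Hv v = Stab(x)` and
  `R.Hb b = Stab(x, y)`, from the two-sided vertex dictionary `hfixN`, the converse edge dictionary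
  `hedgeFixN` and `not_three_fixed_of_ne_bot` (`R.Hb b ≠ 1` fixes the system of `R.Hv v ⊇ R.Hb b`);
* `exists_pair_mem_arithBrGp_iff` — `g ∈ arithBrGp R ι b ↔ g` fixes `(x, y)`: this seat's
  `mem_arithBrGp_iff_fixes_pair` with the adjacency := "end systems of an eventual edge system" and ALL
  its pair inputs discharged (`hEstabN_of_edgeData`, `hErigid_of_edgeData`, `hEinj_of_edgeData`,
  `huniqN_of_levelData`, `exists_ends_translate`).

Binders: `ι` injective with normal image, trees with functorial equivariant transitions, the finite levels
(`quot`, `levelAct`, `levelTrans`), the estrangement consequence `hnobpN`, and the two-sided dictionaries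
`hfixN`, `hstabN`, `hedgeN`, `hedgeFixN` for the restricted action.  No `CompactInVerticial`; no
definition; nothing here takes a side on [IUTchIII] Cor. 3.12.

COMPACT-`C` TWIN (α12-1 disposition of FINDING F-d029g3-1, abc-iut-w4-d029 g3, 2026-08-26): the
estrangement input is taken in the dischargeable form `hnobpNCpt : ∀ C, IsCompact C → (C fixes a compatible
finite-level branch-pair system) → C = ⊥` — the all-subgroups form `hnobpN` of the untwinned file is FALSE over
towers whose finite levels do not separate points (the joint kernel fixes every system).  Every application
is at a COMPACT subgroup (edge-like subgroups and their pairwise meets, `isCompact_of_mem_edgeLikeSubgroups`),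
so the proofs are those of the untwinned file verbatim with `IsCompact` threaded; `_cpt` names throughout.
-/

namespace Literature.AnabelianGeometry.SemiGraphs

open CategoryTheory
open scoped Pointwise

universe v u u'

/-! ### A nontrivial stabiliser determines its end pair -/

namespace ProfiniteSemiGraph

variable {𝒢 : ProfiniteSemiGraph.{u}} {c : TemperedPiChart 𝒢} {Gtp : Type u'} [Group Gtp]
  (ι : c.G →* Gtp) {J : Type v} [Preorder J] [IsDirectedOrder J]
  (T : J → SemiGraph.{u}) (ρ : ∀ j, Gtp →* Aut (T j)) (f : ∀ ⦃i j : J⦄, i ≤ j → (T j ⟶ T i))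
  (level : J → SemiGraph.{u}) [∀ j, Finite (level j).Vertex] [∀ j, Finite (level j).Branch]
  (levelAct : ∀ j, Gtp →* Aut (level j)) (quot : ∀ j, T j ⟶ level j)
  (levelTrans : ∀ ⦃i j : J⦄, i ≤ j → (level j ⟶ level i))

/-- **A nontrivial subgroup of `Π^temp_𝔾` determines the pair of systems of which it is the stabiliser, up
to order**: if `K ≠ 1` is the full stabiliser of `(x, y)` and of `(x', y')` (each pair somewhere
distinct), then `(x', y') = (x, y)` or `(y, x)` — otherwise three pairwise-somewhere-different systems
would be fixed (`not_three_fixed_of_ne_bot_cpt`). [cite: MochizukiSemiAnbd2006, Thm 5.4 (i), p. 66] -/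
theorem ends_eq_or_swap_of_stabilizer_iff_cpt (hT : ∀ j, (T j).IsTree)
    (quot_isImmersion : ∀ j, SemiGraph.IsImmersion (quot j))
    (act_quot : ∀ (j : J) (g : Gtp), (ρ j g).hom ≫ quot j = quot j ≫ (levelAct j g).hom)
    (levelTrans_id : ∀ j, levelTrans (le_refl j) = 𝟙 (level j))
    (levelTrans_comp : ∀ ⦃i j k : J⦄ (hij : i ≤ j) (hjk : j ≤ k),
      levelTrans hjk ≫ levelTrans hij = levelTrans (hij.trans hjk))
    (levelTrans_act : ∀ ⦃i j : J⦄ (h : i ≤ j) (g : Gtp),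
      (levelAct j g).hom ≫ levelTrans h = levelTrans h ≫ (levelAct i g).hom)
    (trans_quot : ∀ ⦃i j : J⦄ (h : i ≤ j), f h ≫ quot i = quot j ≫ levelTrans h)
    (hnobpNCpt : ∀ (C : Subgroup c.G), IsCompact (C : Set c.G) →
      ∀ (j₀ : J) (w : ∀ i : {i : J // j₀ ≤ i}, (level i.1).Vertex)
      (β β' : ∀ i : {i : J // j₀ ≤ i}, (level i.1).Branch),
      (∀ i, β i ≠ β' i ∧ (level i.1).abuts (β i) = some (w i) ∧ (level i.1).abuts (β' i) = some (w i)) →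
      (∀ ⦃i i' : {i : J // j₀ ≤ i}⦄ (h : i.1 ≤ i'.1), (levelTrans h).vertexMap (w i') = w i ∧
        (levelTrans h).branchMap (β i') = β i ∧ (levelTrans h).branchMap (β' i') = β' i) →
      (∀ (i : {i : J // j₀ ≤ i}) (γ : C), (levelAct i.1 (ι γ)).hom.vertexMap (w i) = w i ∧
        (levelAct i.1 (ι γ)).hom.branchMap (β i) = β i ∧
          (levelAct i.1 (ι γ)).hom.branchMap (β' i) = β' i) → C = ⊥)
    {K : Subgroup c.G} (hK : K ≠ ⊥) (hKc : IsCompact (K : Set c.G)) {x y x' y' : ∀ j, (T j).Vertex}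
    (hx : ∀ ⦃i j : J⦄ (h : i ≤ j), (f h).vertexMap (x j) = x i)
    (hy : ∀ ⦃i j : J⦄ (h : i ≤ j), (f h).vertexMap (y j) = y i)
    (hx' : ∀ ⦃i j : J⦄ (h : i ≤ j), (f h).vertexMap (x' j) = x' i)
    (hy' : ∀ ⦃i j : J⦄ (h : i ≤ j), (f h).vertexMap (y' j) = y' i)
    (hKxy : ∀ n : c.G, n ∈ K ↔ (∀ j, (ρ j (ι n)).hom.vertexMap (x j) = x j) ∧
      ∀ j, (ρ j (ι n)).hom.vertexMap (y j) = y j)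
    (hKx'y' : ∀ n : c.G, n ∈ K ↔ (∀ j, (ρ j (ι n)).hom.vertexMap (x' j) = x' j) ∧
      ∀ j, (ρ j (ι n)).hom.vertexMap (y' j) = y' j)
    {i₀ : J} (hxy : x i₀ ≠ y i₀) {i₀' : J} (hx'y' : x' i₀' ≠ y' i₀') :
    (x' = x ∧ y' = y) ∨ (x' = y ∧ y' = x) := by
  have hxf : ∀ n ∈ K, ∀ j, (ρ j (ι n)).hom.vertexMap (x j) = x j := fun n hn => ((hKxy n).mp hn).1
  have hyf : ∀ n ∈ K, ∀ j, (ρ j (ι n)).hom.vertexMap (y j) = y j := fun n hn => ((hKxy n).mp hn).2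
  have hx'f : ∀ n ∈ K, ∀ j, (ρ j (ι n)).hom.vertexMap (x' j) = x' j := fun n hn => ((hKx'y' n).mp hn).1
  have hy'f : ∀ n ∈ K, ∀ j, (ρ j (ι n)).hom.vertexMap (y' j) = y' j := fun n hn => ((hKx'y' n).mp hn).2
  -- a fixed system different somewhere from both `x` and `y` is impossible
  have mem_pair : ∀ {a : ∀ j, (T j).Vertex}, (∀ ⦃i j : J⦄ (h : i ≤ j), (f h).vertexMap (a j) = a i) →
      (∀ n ∈ K, ∀ j, (ρ j (ι n)).hom.vertexMap (a j) = a j) → a = x ∨ a = y := by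
    intro a ha haf
    by_contra hnot
    push Not at hnot
    obtain ⟨hax, hay⟩ := hnot
    obtain ⟨i, hi⟩ : ∃ i, a i ≠ x i := by
      by_contra hall; push Not at hall; exact hax (funext hall)
    obtain ⟨i', hi'⟩ : ∃ i, a i ≠ y i := by
      by_contra hall; push Not at hall; exact hay (funext hall)
    exact not_three_fixed_of_ne_bot_cpt ι T ρ f level levelAct quot levelTrans hT quot_isImmersion act_quot
      levelTrans_id levelTrans_comp levelTrans_act trans_quot hnobpNCpt hK hKc hx hy ha hxf hyf haf hxy hi'.symm
      hi.symm
  rcases mem_pair hx' hx'f with h1 | h1 <;> rcases mem_pair hy' hy'f with h2 | h2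
  · exact absurd (congrFun (h1.trans h2.symm) i₀') hx'y'
  · exact Or.inl ⟨h1, h2⟩
  · exact Or.inr ⟨h1, h2⟩
  · exact absurd (congrFun (h1.trans h2.symm) i₀') hx'y'

/-! ### The reference pro-branch of the chosen representatives -/

/-- **The reference pro-branch `(x, y)` of `R.Hb b ⊆ R.Hv v`, DISCHARGED** (gen 0's binders `hX`/`hY`):
by the converse edge dictionary `hedgeFixN` the edge-like `R.Hb b` is the full stabiliser of an end pair
`(x, y)`; by the vertex dictionary `hfixN` the verticial `R.Hv v ⊇ R.Hb b` is the full stabiliser of some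
`X`, fixed by `R.Hb b ≠ 1`; so `X ∈ {x, y}` (`not_three_fixed_of_ne_bot_cpt`) and, after possibly swapping,
`R.Hv v` is the stabiliser of `x`. [cite: MochizukiSemiAnbd2006, §5, p. 65] -/
theorem exists_referencePair_cpt (h𝒢 : 𝒢.Thm37Hypotheses) (R : ChartRepresentatives c)
    (hT : ∀ j, (T j).IsTree)
    (trans_act : ∀ ⦃i j : J⦄ (h : i ≤ j) (g : Gtp), (ρ j g).hom ≫ f h = f h ≫ (ρ i g).hom)
    (quot_isImmersion : ∀ j, SemiGraph.IsImmersion (quot j))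
    (act_quot : ∀ (j : J) (g : Gtp), (ρ j g).hom ≫ quot j = quot j ≫ (levelAct j g).hom)
    (levelTrans_id : ∀ j, levelTrans (le_refl j) = 𝟙 (level j))
    (levelTrans_comp : ∀ ⦃i j k : J⦄ (hij : i ≤ j) (hjk : j ≤ k),
      levelTrans hjk ≫ levelTrans hij = levelTrans (hij.trans hjk))
    (levelTrans_act : ∀ ⦃i j : J⦄ (h : i ≤ j) (g : Gtp),
      (levelAct j g).hom ≫ levelTrans h = levelTrans h ≫ (levelAct i g).hom)
    (trans_quot : ∀ ⦃i j : J⦄ (h : i ≤ j), f h ≫ quot i = quot j ≫ levelTrans h)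
    (hnobpNCpt : ∀ (C : Subgroup c.G), IsCompact (C : Set c.G) →
      ∀ (j₀ : J) (w : ∀ i : {i : J // j₀ ≤ i}, (level i.1).Vertex)
      (β β' : ∀ i : {i : J // j₀ ≤ i}, (level i.1).Branch),
      (∀ i, β i ≠ β' i ∧ (level i.1).abuts (β i) = some (w i) ∧ (level i.1).abuts (β' i) = some (w i)) →
      (∀ ⦃i i' : {i : J // j₀ ≤ i}⦄ (h : i.1 ≤ i'.1), (levelTrans h).vertexMap (w i') = w i ∧
        (levelTrans h).branchMap (β i') = β i ∧ (levelTrans h).branchMap (β' i') = β' i) →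
      (∀ (i : {i : J // j₀ ≤ i}) (γ : C), (levelAct i.1 (ι γ)).hom.vertexMap (w i) = w i ∧
        (levelAct i.1 (ι γ)).hom.branchMap (β i) = β i ∧
          (levelAct i.1 (ι γ)).hom.branchMap (β' i) = β' i) → C = ⊥)
    (hfixN : ∀ (v : 𝒢.graph.Vertex) (H : Subgroup c.G), H ∈ verticialSubgroups c v →
      ∃ x : ∀ j, (T j).Vertex, (∀ ⦃i j : J⦄ (h : i ≤ j), (f h).vertexMap (x j) = x i) ∧
        ∀ n : c.G, n ∈ H ↔ ∀ j, (ρ j (ι n)).hom.vertexMap (x j) = x j)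
    (hedgeFixN : ∀ (e : 𝒢.graph.Edge) (K : Subgroup c.G), K ∈ edgeLikeSubgroups c e →
      ∃ (j₁ : J) (ε : ∀ j : {j : J // j₁ ≤ j}, (T j.1).Edge) (c₁ c₂ : ∀ j : {j : J // j₁ ≤ j}, (T j.1).Branch)
        (x₁ x₂ : ∀ j, (T j).Vertex),
        (∀ ⦃i j : J⦄ (h : i ≤ j), (f h).vertexMap (x₁ j) = x₁ i) ∧
        (∀ ⦃i j : J⦄ (h : i ≤ j), (f h).vertexMap (x₂ j) = x₂ i) ∧
        (∀ j, x₁ j.1 ≠ x₂ j.1 ∧ (T j.1).edgeOf (c₁ j) = ε j ∧ (T j.1).edgeOf (c₂ j) = ε j ∧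
          (T j.1).abuts (c₁ j) = some (x₁ j.1) ∧ (T j.1).abuts (c₂ j) = some (x₂ j.1)) ∧
        ∀ n : c.G, n ∈ K ↔ ∀ j, (ρ j.1 (ι n)).hom.edgeMap (ε j) = ε j ∧
          ∀ b : (T j.1).Branch, (T j.1).edgeOf b = ε j → (ρ j.1 (ι n)).hom.branchMap b = b)
    {b : 𝒢.graph.Branch} {v : 𝒢.graph.Vertex} (hb : 𝒢.graph.abuts b = some v) :
    ∃ (x y : ∀ j, (T j).Vertex), (∀ ⦃i j : J⦄ (h : i ≤ j), (f h).vertexMap (x j) = x i) ∧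
      (∀ ⦃i j : J⦄ (h : i ≤ j), (f h).vertexMap (y j) = y i) ∧
      (∃ (j₁ : J) (ε : ∀ j : {j : J // j₁ ≤ j}, (T j.1).Edge)
        (c₁ c₂ : ∀ j : {j : J // j₁ ≤ j}, (T j.1).Branch),
        ∀ j : {j : J // j₁ ≤ j}, x j.1 ≠ y j.1 ∧ (T j.1).edgeOf (c₁ j) = ε j ∧
          (T j.1).edgeOf (c₂ j) = ε j ∧ (T j.1).abuts (c₁ j) = some (x j.1) ∧ (T j.1).abuts (c₂ j) = some (y j.1)) ∧
      (∀ n : c.G, n ∈ R.Hv v ↔ ∀ j, (ρ j (ι n)).hom.vertexMap (x j) = x j) ∧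
      ∀ n : c.G, n ∈ R.Hb b ↔ (∀ j, (ρ j (ι n)).hom.vertexMap (x j) = x j) ∧
        ∀ j, (ρ j (ι n)).hom.vertexMap (y j) = y j := by
  have hequivN : ∀ ⦃i j : J⦄ (h : i ≤ j) (n : c.G) (z : (T j).Vertex),
      (f h).vertexMap (((ρ j).comp ι n).hom.vertexMap z) = ((ρ i).comp ι n).hom.vertexMap ((f h).vertexMap z) :=
    fun i j h n z => trans_act_vertexMap' T ρ f trans_act h (ι n) z
  obtain ⟨j₁, ε, c₁, c₂, x, y, hx, hy, hends, hbiff⟩ := hedgeFixN (𝒢.graph.edgeOf b) (R.Hb b) (R.Hb_mem b)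
  have hbp : ∀ n : c.G, n ∈ R.Hb b ↔ (∀ j, (ρ j (ι n)).hom.vertexMap (x j) = x j) ∧
      ∀ j, (ρ j (ι n)).hom.vertexMap (y j) = y j := fun n => by
    rw [hbiff n]; exact edgeSystem_fixed_iff_ends_fixed T (fun j => (ρ j).comp ι) f hT hequivN hx hy hends n
  obtain ⟨X, hXc, hXiff⟩ := hfixN v (R.Hv v) (R.Hv_mem v)
  have hKbot : R.Hb b ≠ ⊥ := ne_bot_of_mem_edgeLikeSubgroups verticialInjective_holds h𝒢 c (R.Hb_mem b)
  have hXf : ∀ n ∈ R.Hb b, ∀ j, (ρ j (ι n)).hom.vertexMap (X j) = X j :=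
    fun n hn => (hXiff n).mp (R.Hb_le b v hb hn)
  have hxf : ∀ n ∈ R.Hb b, ∀ j, (ρ j (ι n)).hom.vertexMap (x j) = x j := fun n hn => ((hbp n).mp hn).1
  have hyf : ∀ n ∈ R.Hb b, ∀ j, (ρ j (ι n)).hom.vertexMap (y j) = y j := fun n hn => ((hbp n).mp hn).2
  have hxy : x j₁ ≠ y j₁ := (hends ⟨j₁, le_rfl⟩).1
  -- `X ∈ {x, y}`
  have hX : X = x ∨ X = y := by
    by_contra hnot
    push Not at hnot
    obtain ⟨hXx, hXy⟩ := hnot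
    obtain ⟨i, hi⟩ : ∃ i, X i ≠ x i := by
      by_contra hall; push Not at hall; exact hXx (funext hall)
    obtain ⟨i', hi'⟩ : ∃ i, X i ≠ y i := by
      by_contra hall; push Not at hall; exact hXy (funext hall)
    exact not_three_fixed_of_ne_bot_cpt ι T ρ f level levelAct quot levelTrans hT quot_isImmersion act_quot
      levelTrans_id levelTrans_comp levelTrans_act trans_quot hnobpNCpt hKbot
      (isCompact_of_mem_edgeLikeSubgroups c (R.Hb_mem b)) hx hy hXc hxf hyf hXf hxy hi'.symm
      hi.symm
  rcases hX with rfl | rfl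
  · exact ⟨X, y, hXc, hy, ⟨j₁, ε, c₁, c₂, hends⟩, hXiff, hbp⟩
  · refine ⟨X, x, hXc, hx, ⟨j₁, ε, c₂, c₁, fun j => ?_⟩, hXiff, fun n => (hbp n).trans and_comm⟩
    obtain ⟨hne, h1, h2, h3, h4⟩ := hends j
    exact ⟨hne.symm, h2, h1, h4, h3⟩

/-! ### `Π^temp_{𝔊,b}` as a pair-stabiliser, dictionary inputs only -/

/-- **`Π^temp_{𝔊,b} = arithBrGp R ι b` is the stabiliser in `Π^temp_𝔊` of the reference pro-branch
`(x, y)` of `b`**, with ALL inputs dictionary-shaped: abc-iut-w4-d059's `mem_arithBrGp_iff_fixes_pair` with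
the adjacency relation := "end systems of an eventual edge system", its pair inputs discharged by
`ArithEdgeStabilizerInputs.lean`, and the reference pair from `exists_referencePair_cpt`.
[cite: MochizukiSemiAnbd2006, §5, p. 65] -/
theorem exists_pair_mem_arithBrGp_iff_cpt (h𝒢 : 𝒢.Thm37Hypotheses) (R : ChartRepresentatives c)
    (hι : Function.Injective ι) (hnorm : (ι.range).Normal) (hT : ∀ j, (T j).IsTree)
    (f_id : ∀ j, f (le_refl j) = 𝟙 (T j))
    (f_comp : ∀ ⦃i j k : J⦄ (hij : i ≤ j) (hjk : j ≤ k), f hjk ≫ f hij = f (hij.trans hjk))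
    (trans_act : ∀ ⦃i j : J⦄ (h : i ≤ j) (g : Gtp), (ρ j g).hom ≫ f h = f h ≫ (ρ i g).hom)
    (quot_isImmersion : ∀ j, SemiGraph.IsImmersion (quot j))
    (act_quot : ∀ (j : J) (g : Gtp), (ρ j g).hom ≫ quot j = quot j ≫ (levelAct j g).hom)
    (levelTrans_id : ∀ j, levelTrans (le_refl j) = 𝟙 (level j))
    (levelTrans_comp : ∀ ⦃i j k : J⦄ (hij : i ≤ j) (hjk : j ≤ k),
      levelTrans hjk ≫ levelTrans hij = levelTrans (hij.trans hjk))
    (levelTrans_act : ∀ ⦃i j : J⦄ (h : i ≤ j) (g : Gtp),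
      (levelAct j g).hom ≫ levelTrans h = levelTrans h ≫ (levelAct i g).hom)
    (trans_quot : ∀ ⦃i j : J⦄ (h : i ≤ j), f h ≫ quot i = quot j ≫ levelTrans h)
    (hnobpNCpt : ∀ (C : Subgroup c.G), IsCompact (C : Set c.G) →
      ∀ (j₀ : J) (w : ∀ i : {i : J // j₀ ≤ i}, (level i.1).Vertex)
      (β β' : ∀ i : {i : J // j₀ ≤ i}, (level i.1).Branch),
      (∀ i, β i ≠ β' i ∧ (level i.1).abuts (β i) = some (w i) ∧ (level i.1).abuts (β' i) = some (w i)) →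
      (∀ ⦃i i' : {i : J // j₀ ≤ i}⦄ (h : i.1 ≤ i'.1), (levelTrans h).vertexMap (w i') = w i ∧
        (levelTrans h).branchMap (β i') = β i ∧ (levelTrans h).branchMap (β' i') = β' i) →
      (∀ (i : {i : J // j₀ ≤ i}) (γ : C), (levelAct i.1 (ι γ)).hom.vertexMap (w i) = w i ∧
        (levelAct i.1 (ι γ)).hom.branchMap (β i) = β i ∧
          (levelAct i.1 (ι γ)).hom.branchMap (β' i) = β' i) → C = ⊥)
    (hfixN : ∀ (v : 𝒢.graph.Vertex) (H : Subgroup c.G), H ∈ verticialSubgroups c v →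
      ∃ x : ∀ j, (T j).Vertex, (∀ ⦃i j : J⦄ (h : i ≤ j), (f h).vertexMap (x j) = x i) ∧
        ∀ n : c.G, n ∈ H ↔ ∀ j, (ρ j (ι n)).hom.vertexMap (x j) = x j)
    (hstabN : ∀ x : ∀ j, (T j).Vertex, (∀ ⦃i j : J⦄ (h : i ≤ j), (f h).vertexMap (x j) = x i) →
      ∃ (v : 𝒢.graph.Vertex) (H : Subgroup c.G), H ∈ verticialSubgroups c v ∧
        ∀ n : c.G, n ∈ H ↔ ∀ j, (ρ j (ι n)).hom.vertexMap (x j) = x j)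
    (hedgeN : ∀ (j₁ : J) (ε : ∀ j : {j : J // j₁ ≤ j}, (T j.1).Edge),
      (∀ ⦃i j : {j : J // j₁ ≤ j}⦄ (h : i.1 ≤ j.1), (f h).edgeMap (ε j) = ε i) →
      ∃ (e : 𝒢.graph.Edge) (L : Subgroup c.G), L ∈ edgeLikeSubgroups c e ∧
        ∀ n : c.G, n ∈ L ↔ ∀ j, (ρ j.1 (ι n)).hom.edgeMap (ε j) = ε j ∧
          ∀ b : (T j.1).Branch, (T j.1).edgeOf b = ε j → (ρ j.1 (ι n)).hom.branchMap b = b)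
    (hedgeFixN : ∀ (e : 𝒢.graph.Edge) (K : Subgroup c.G), K ∈ edgeLikeSubgroups c e →
      ∃ (j₁ : J) (ε : ∀ j : {j : J // j₁ ≤ j}, (T j.1).Edge) (c₁ c₂ : ∀ j : {j : J // j₁ ≤ j}, (T j.1).Branch)
        (x₁ x₂ : ∀ j, (T j).Vertex),
        (∀ ⦃i j : J⦄ (h : i ≤ j), (f h).vertexMap (x₁ j) = x₁ i) ∧
        (∀ ⦃i j : J⦄ (h : i ≤ j), (f h).vertexMap (x₂ j) = x₂ i) ∧
        (∀ j, x₁ j.1 ≠ x₂ j.1 ∧ (T j.1).edgeOf (c₁ j) = ε j ∧ (T j.1).edgeOf (c₂ j) = ε j ∧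
          (T j.1).abuts (c₁ j) = some (x₁ j.1) ∧ (T j.1).abuts (c₂ j) = some (x₂ j.1)) ∧
        ∀ n : c.G, n ∈ K ↔ ∀ j, (ρ j.1 (ι n)).hom.edgeMap (ε j) = ε j ∧
          ∀ b : (T j.1).Branch, (T j.1).edgeOf b = ε j → (ρ j.1 (ι n)).hom.branchMap b = b)
    {b : 𝒢.graph.Branch} {v : 𝒢.graph.Vertex} (hb : 𝒢.graph.abuts b = some v) :
    ∃ (x y : ∀ j, (T j).Vertex), (∀ ⦃i j : J⦄ (h : i ≤ j), (f h).vertexMap (x j) = x i) ∧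
      (∀ ⦃i j : J⦄ (h : i ≤ j), (f h).vertexMap (y j) = y i) ∧
      (∃ (j₁ : J) (ε : ∀ j : {j : J // j₁ ≤ j}, (T j.1).Edge)
        (c₁ c₂ : ∀ j : {j : J // j₁ ≤ j}, (T j.1).Branch),
        ∀ j : {j : J // j₁ ≤ j}, x j.1 ≠ y j.1 ∧ (T j.1).edgeOf (c₁ j) = ε j ∧
          (T j.1).edgeOf (c₂ j) = ε j ∧ (T j.1).abuts (c₁ j) = some (x j.1) ∧ (T j.1).abuts (c₂ j) = some (y j.1)) ∧
      (∀ n : c.G, n ∈ R.Hb b ↔ (∀ j, (ρ j (ι n)).hom.vertexMap (x j) = x j) ∧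
        ∀ j, (ρ j (ι n)).hom.vertexMap (y j) = y j) ∧
      ∀ g : Gtp, g ∈ arithBrGp R ι b ↔
        (∀ j, (ρ j g).hom.vertexMap (x j) = x j) ∧ ∀ j, (ρ j g).hom.vertexMap (y j) = y j := by
  obtain ⟨x, y, hx, hy, hxy, hvx, hbxy⟩ := exists_referencePair_cpt ι T ρ f level levelAct quot levelTrans h𝒢 R
    hT trans_act quot_isImmersion act_quot levelTrans_id levelTrans_comp levelTrans_act trans_quot hnobpNCpt
    hfixN hedgeFixN hb
  refine ⟨x, y, hx, hy, hxy, hbxy, fun g => ?_⟩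
  exact mem_arithBrGp_iff_fixes_pair ι T ρ f h𝒢 R hι hnorm (trans_act_vertexMap' T ρ f trans_act) hstabN
    (huniqN_of_levelData ι T ρ f level quot h𝒢 hT f_id f_comp trans_act quot_isImmersion hedgeN)
    (fun x y => ∃ (j₁ : J) (ε : ∀ j : {j : J // j₁ ≤ j}, (T j.1).Edge)
      (c₁ c₂ : ∀ j : {j : J // j₁ ≤ j}, (T j.1).Branch),
      ∀ j : {j : J // j₁ ≤ j}, x j.1 ≠ y j.1 ∧ (T j.1).edgeOf (c₁ j) = ε j ∧
        (T j.1).edgeOf (c₂ j) = ε j ∧ (T j.1).abuts (c₁ j) = some (x j.1) ∧ (T j.1).abuts (c₂ j) = some (y j.1))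
    (fun x y g hxy => exists_ends_translate T ρ hxy g)
    (fun x y hx hy hxy => hEstabN_of_edgeData ι T ρ f hT trans_act hedgeN x y hx hy hxy)
    (fun _ _ _ e e' K K' hK hK' _ _ hc => hErigid_of_edgeData_cpt ι T ρ f level levelAct quot levelTrans h𝒢 hT
      trans_act quot_isImmersion act_quot levelTrans_id levelTrans_comp levelTrans_act trans_quot hnobpNCpt
      hedgeFixN hK hK' hc)
    (fun x y y' hx hy hy' hxy hxy' hiff => hEinj_of_edgeData_cpt ι T ρ f level levelAct quot levelTrans h𝒢 hT
      trans_act quot_isImmersion act_quot levelTrans_id levelTrans_comp levelTrans_act trans_quot hnobpNCpt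
      hedgeN x y y' hx hy hy' hxy hxy' hiff)
    hb hx hy hxy hvx hbxy g

end ProfiniteSemiGraph

end Literature.AnabelianGeometry.SemiGraphs
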